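import Literature.AlgebraicGeometry.HodgeTheory.HodgeClassesIsogenyInvariance
import Literature.AlgebraicGeometry.HodgeTheory.WeilClassesIsogenyDescent
import Literature.AlgebraicGeometry.HodgeTheory.HodgeTypeExteriorProduct
import Literature.AlgebraicGeometry.Motives.AbelianVarietyProductIsogeny
import Literature.AlgebraicTopology.SingularHomology.CupProductProofs
import HarnessLib

/-!
# `HodgeClassesProductSpan` is symmetric, isogeny-invariant in both factors, and inherited by abelian sub-quotients of the factors

Family `hodge`, layer `Literature/AlgebraicGeometry/HodgeTheory`. Theorems only: no definition, no
named fact; net debt 0; axioms standard. Written for the cell `pub-hodge-ring2` (literature seat,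
generation 38; brick E15b), general-purpose.

`HodgeClassesProductSpan A C` (`HodgeTheory/HodgeGroupProductCMFactor`) says: every rational
`(p,p)`-class on `A × C` lies in the `ℂ`-span of the exterior products `pr_A^* a ∪ pr_C^* b` of
rational Hodge classes of the factors (Moonen–Zarhin 1999 §3: "`B•(X₁ × X₂)` is generated by the
elements coming from `B•(X₁)` and `B•(X₂)`"). It is the conclusion of the cell's product binders
(Lombardo 2016 Lemma 3.4 / Moonen–Zarhin (3.2)(2) / Gordon) and the hypothesis of the kernel
`hodgeConjectureFor_prod_iff_of_productSpan`. This file proves the formal bookkeeping every user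
of the predicate needs and the tree lacked:

* `map_prodMap_mem_hodgeProductClasses` — for homomorphisms `t₁ : A' → A`, `t₂ : C' → C`, the
  pull-back `(t₁ × t₂)^*` carries exterior products of Hodge classes of `A`, `C` to exterior products
  of Hodge classes of `A'`, `C'` (`f^*(x ∪ y) = f^* x ∪ f^* y`, Hatcher Prop. 3.10; pull-backs preserve
  rationality and Hodge type, Voisin I §7.3.2);
* **`HodgeClassesProductSpan.of_comp_eq_nsmul_id`** — if `t₁ ≫ h₁ = [n₁]` on `A'` and
  `t₂ ≫ h₂ = [n₂]` on `C'` (`nᵢ ≠ 0`: `A'`, `C'` are direct summands of `A`, `C` up to isogeny), then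
  `HodgeClassesProductSpan A C → HodgeClassesProductSpan A' C'`: with `T = t₁ × t₂`,
  `H = (n₂ h₁) × (n₁ h₂)` one has `T ≫ H = [n₁ n₂]` on `A' × C'`, so for a rational `(p,p)`-class `c`
  on `A' × C'`, `H^* c` is a rational `(p,p)`-class on `A × C`, hence in the span of product classes,
  and `(n₁ n₂)^{2p} c = T^* H^* c` is in the span of product classes of `A' × C'`
  (Mumford §19: `[n]^* = nᵏ` on `Hᵏ`, the tree's `complexBetti_map_map_of_comp_eq_nsmul_id`);
* **`HodgeClassesProductSpan.symm` / `hodgeClassesProductSpan_comm`** — the predicate is symmetric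
  in `(A, C)`: pull back along the switch `C × A ≅ A × C` and use graded commutativity of `∪` in
  even degrees (Hatcher Thm. 3.11, the tree's theorem `cupProduct_gradedComm_holds`);
* isogeny invariance in each factor, both directions (`.of_isIsogeny_hom_left/right`,
  `.of_isIsogeny_inv_left/right`, `.of_isIsogenous_left/right`, `…_iff_of_isIsogenous`), via the
  quasi-inverse of an isogeny (`f ≫ g = [n]`, `g ≫ f = [n]`, the tree's theorem
  `AbelianVariety.IsIsogeny.exists_nsmul_inverse_holds`);
* inheritance by abelian subvarieties (`.of_isClosedImmersion_left/right`) and quotient abelian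
  varieties (`.of_surjective_hom_left/right`) of either factor (Poincaré's complete reducibility —
  the tree's theorems `AbelianVariety.exists_comp_eq_nsmul_id_of_isClosedImmersion` /
  `_of_surjective`).

(The first-factor RETRACT case `s ≫ π = 𝟙` was proved by the cell `pub-hodgecm2` inside
`Summits/HodgeConjecture/CorCM/Assembly/TypeIVThreefoldProductSpanHolds`
(`hodgeClassesProductSpan_of_retract`); the present file is the Literature-side general form.)
Honest scope: pure bookkeeping about a predicate on pairs of complex abelian varieties; nothing here
is a case of the Hodge conjecture. research route conditional on HC_CM; not a corollary;
Q11.4-sentence-2 already refuted in dim ≥ 3 (cell framing sentence; this file takes no hypothesis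
`HC_CM`).

## References

* [MoonenZarhin1999LowDim] B. Moonen, Yu. Zarhin, *Hodge classes on abelian varieties of low
  dimension*, Math. Ann. 315 (1999) 711–733, §3 first paragraph and (3.1).
* [MumfordAV1970] D. Mumford, *Abelian Varieties* (1970), §19 Thm. 1 (Poincaré's complete
  reducibility) and Remark p. 169 (`[n]^*`, quasi-inverse of an isogeny).
* [vanGeemen1994HodgeAV] B. van Geemen, *An introduction to the Hodge conjecture for abelian
  varieties*, LNM 1594 (1994), §3.6–3.7 (isogenies and sub-Hodge structures act compatibly on `B•`).
* [Hatcher2002] A. Hatcher, *Algebraic Topology* (2002), Prop. 3.10 (naturality of `∪`),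
  Thm. 3.11 (graded commutativity).
* [VoisinHodgeI2002] C. Voisin, *Hodge Theory and Complex Algebraic Geometry I* (2002), §7.3.2
  (pull-backs are morphisms of Hodge structures), §11.3.
-/

noncomputable section

open CategoryTheory MonoidalCategory CartesianMonoidalCategory AlgebraicGeometry
open Literature.AlgebraicTopology.SingularHomology

namespace Literature.AlgebraicGeometry.HodgeTheory

open Literature.AlgebraicGeometry.Motives

variable {A A' C C' : Motives.AbelianVariety ℂ}

/-! ### §1 Pull-back of exterior products of Hodge classes along `t₁ × t₂` -/

/-- **`(t₁ × t₂)^*` carries exterior products of Hodge classes to exterior products of Hodge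
classes**: for homomorphisms `t₁ : A' → A`, `t₂ : C' → C` and `x = pr_A^* a ∪ pr_C^* b` with `a`, `b`
rational Hodge classes on `A`, `C`, `(t₁ × t₂)^* x = pr_{A'}^* (t₁^* a) ∪ pr_{C'}^* (t₂^* b)` is an
exterior product of rational Hodge classes on `A'`, `C'` (naturality of `∪`; pull-backs preserve
rationality and Hodge type). [cite: Hatcher2002, Prop. 3.10] [cite: VoisinHodgeI2002, §7.3.2] -/
theorem map_prodMap_mem_hodgeProductClasses (t₁ : A' ⟶ A) (t₂ : C' ⟶ C) {p : ℕ}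
    {x : complexBetti (A.X ⊗ C.X) (2 * p)} (hx : x ∈ hodgeProductClasses A C p) :
    complexBetti.map (AbelianVariety.prodMap t₁ t₂).hom.hom.hom (2 * p) x ∈
      hodgeProductClasses A' C' p := by
  have hA : IsSmoothProjective A.dim A.X := AbelianVariety.isSmoothProjective_holds
  have hA' : IsSmoothProjective A'.dim A'.X := AbelianVariety.isSmoothProjective_holds
  have hC : IsSmoothProjective C.dim C.X := AbelianVariety.isSmoothProjective_holds
  have hC' : IsSmoothProjective C'.dim C'.X := AbelianVariety.isSmoothProjective_holds
  obtain ⟨l, k, hlk, a, b, ha, ha', hb, hb', rfl⟩ := hx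
  set T : A'.prod C' ⟶ A.prod C := AbelianVariety.prodMap t₁ t₂ with hTdef
  have hT₁ : T ≫ AbelianVariety.fst A C = AbelianVariety.fst A' C' ≫ t₁ := AbelianVariety.prodMap_fst _ _
  have hT₂ : T ≫ AbelianVariety.snd A C = AbelianVariety.snd A' C' ≫ t₂ := AbelianVariety.prodMap_snd _ _
  have hFx : complexBetti.map T.hom.hom.hom (2 * p)
      (cupProduct hlk (complexBetti.map (fst A.X C.X) (2 * l) a) (complexBetti.map (snd A.X C.X) (2 * k) b)) =
      cupProduct (X := ComplexPoints (A'.X ⊗ C'.X)) hlk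
        (complexBetti.map T.hom.hom.hom (2 * l) (complexBetti.map (fst A.X C.X) (2 * l) a))
        (complexBetti.map T.hom.hom.hom (2 * k) (complexBetti.map (snd A.X C.X) (2 * k) b)) :=
    cupProduct_map _ hlk _ _
  have hXa : complexBetti.map T.hom.hom.hom (2 * l) (complexBetti.map (fst A.X C.X) (2 * l) a) =
      complexBetti.map (fst A'.X C'.X) (2 * l) (complexBetti.map t₁.hom.hom.hom (2 * l) a) := by
    have e := abelianVarietyHom_map_map_apply T (AbelianVariety.fst A C) a
    rw [hT₁, ← abelianVarietyHom_map_map_apply] at e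
    exact e
  have hYb : complexBetti.map T.hom.hom.hom (2 * k) (complexBetti.map (snd A.X C.X) (2 * k) b) =
      complexBetti.map (snd A'.X C'.X) (2 * k) (complexBetti.map t₂.hom.hom.hom (2 * k) b) := by
    have e := abelianVarietyHom_map_map_apply T (AbelianVariety.snd A C) b
    rw [hT₂, ← abelianVarietyHom_map_map_apply] at e
    exact e
  rw [hFx, hXa, hYb]
  exact ⟨l, k, hlk, complexBetti.map t₁.hom.hom.hom (2 * l) a, complexBetti.map t₂.hom.hom.hom (2 * k) b,
    ha.map _, ha'.map_of_isSmoothProjective hA' hA _, hb.map _, hb'.map_of_isSmoothProjective hC' hC _, rfl⟩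

/-- `(t₁ × t₂)^*` carries the span of the exterior products of Hodge classes of `A`, `C` into the
span of those of `A'`, `C'`. [cite: Hatcher2002, Prop. 3.10] [cite: VoisinHodgeI2002, §7.3.2] -/
theorem map_prodMap_mem_span_hodgeProductClasses (t₁ : A' ⟶ A) (t₂ : C' ⟶ C) {p : ℕ}
    {x : complexBetti (A.X ⊗ C.X) (2 * p)} (hx : x ∈ Submodule.span ℂ (hodgeProductClasses A C p)) :
    complexBetti.map (AbelianVariety.prodMap t₁ t₂).hom.hom.hom (2 * p) x ∈
      Submodule.span ℂ (hodgeProductClasses A' C' p) := by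
  refine Submodule.span_induction (p := fun x _ ↦
      complexBetti.map (AbelianVariety.prodMap t₁ t₂).hom.hom.hom (2 * p) x ∈
        Submodule.span ℂ (hodgeProductClasses A' C' p)) ?_ ?_ ?_ ?_ hx
  · intro x hx
    exact Submodule.subset_span (map_prodMap_mem_hodgeProductClasses t₁ t₂ hx)
  · rw [map_zero]
    exact Submodule.zero_mem _
  · intro x y _ _ hx hy
    rw [map_add]
    exact Submodule.add_mem _ hx hy
  · intro s x _ hx
    rw [map_smul]
    exact Submodule.smul_mem _ s hx

/-! ### §2 Transport along quasi-retracts in both factors -/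

/-- `(t₁ × t₂) ≫ ((n₂ h₁) × (n₁ h₂)) = [n₁ n₂]` on `A' × C'` when `t₁ ≫ h₁ = [n₁]`, `t₂ ≫ h₂ = [n₂]`
(homomorphisms into a product are determined by their components, Mumford §19). [cite: MumfordAV1970, §19] -/
theorem prodMap_comp_prodMap_nsmul_eq (t₁ : A' ⟶ A) (h₁ : A ⟶ A') {n₁ : ℕ} (ht₁ : t₁ ≫ h₁ = n₁ • 𝟙 A')
    (t₂ : C' ⟶ C) (h₂ : C ⟶ C') {n₂ : ℕ} (ht₂ : t₂ ≫ h₂ = n₂ • 𝟙 C') :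
    AbelianVariety.prodMap t₁ t₂ ≫ AbelianVariety.prodMap (n₂ • h₁) (n₁ • h₂) =
      (n₁ * n₂) • 𝟙 (A'.prod C') := by
  apply AbelianVariety.prod_hom_ext
  · rw [Category.assoc, AbelianVariety.prodMap_fst, AbelianVariety.prodMap_fst_assoc,
      Preadditive.comp_nsmul, ht₁, Preadditive.comp_nsmul, Preadditive.comp_nsmul, Category.comp_id,
      Preadditive.nsmul_comp, Category.id_comp, smul_smul, mul_comm n₂ n₁]
  · rw [Category.assoc, AbelianVariety.prodMap_snd, AbelianVariety.prodMap_snd_assoc,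
      Preadditive.comp_nsmul, ht₂, Preadditive.comp_nsmul, Preadditive.comp_nsmul, Category.comp_id,
      Preadditive.nsmul_comp, Category.id_comp, smul_smul]

/-- **`HodgeClassesProductSpan` passes to direct summands up to isogeny of both factors**: if
`t₁ : A' → A`, `h₁ : A → A'` satisfy `t₁ ≫ h₁ = [n₁]` (`n₁ ≠ 0`) and `t₂ : C' → C`, `h₂ : C → C'`
satisfy `t₂ ≫ h₂ = [n₂]` (`n₂ ≠ 0`), then `HodgeClassesProductSpan A C → HodgeClassesProductSpan A' C'`.
For a rational `(p,p)`-class `c` on `A' × C'`: `H^* c` (`H = (n₂ h₁) × (n₁ h₂)`) is a rational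
`(p,p)`-class on `A × C`, hence a combination of exterior products of Hodge classes; pulling back by
`T = t₁ × t₂` gives `T^* H^* c = [n₁ n₂]^* c = (n₁ n₂)^{2p} c` as a combination of exterior products
of Hodge classes of `A'`, `C'`. [cite: MumfordAV1970, §19 Remark p. 169] [cite: vanGeemen1994HodgeAV, §3.6–3.7]
[cite: MoonenZarhin1999LowDim, §3 (3.1)] -/
theorem HodgeClassesProductSpan.of_comp_eq_nsmul_id
    (t₁ : A' ⟶ A) (h₁ : A ⟶ A') {n₁ : ℕ} (hn₁ : n₁ ≠ 0) (ht₁ : t₁ ≫ h₁ = n₁ • 𝟙 A')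
    (t₂ : C' ⟶ C) (h₂ : C ⟶ C') {n₂ : ℕ} (hn₂ : n₂ ≠ 0) (ht₂ : t₂ ≫ h₂ = n₂ • 𝟙 C')
    (h : HodgeClassesProductSpan A C) : HodgeClassesProductSpan A' C' := by
  intro p c hc hpp
  have hA : IsSmoothProjective A.dim A.X := AbelianVariety.isSmoothProjective_holds
  have hA' : IsSmoothProjective A'.dim A'.X := AbelianVariety.isSmoothProjective_holds
  have hC : IsSmoothProjective C.dim C.X := AbelianVariety.isSmoothProjective_holds
  have hC' : IsSmoothProjective C'.dim C'.X := AbelianVariety.isSmoothProjective_holds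
  have hAC : IsSmoothProjective (A.dim + C.dim) (A.X ⊗ C.X) := IsSmoothProjective.tensor_holds hA hC
  have hA'C' : IsSmoothProjective (A'.dim + C'.dim) (A'.X ⊗ C'.X) := IsSmoothProjective.tensor_holds hA' hC'
  set T : A'.prod C' ⟶ A.prod C := AbelianVariety.prodMap t₁ t₂ with hTdef
  set H : A.prod C ⟶ A'.prod C' := AbelianVariety.prodMap (n₂ • h₁) (n₁ • h₂) with hHdef
  have hTH : T ≫ H = (n₁ * n₂) • 𝟙 (A'.prod C') := prodMap_comp_prodMap_nsmul_eq t₁ h₁ ht₁ t₂ h₂ ht₂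
  -- `H^* c` is a rational `(p,p)`-class on `A × C`, hence in the span of the product classes
  set c₁ : complexBetti (A.X ⊗ C.X) (2 * p) := complexBetti.map H.hom.hom.hom (2 * p) c with hc₁
  have hc₁r : IsRationalClass c₁ := hc.map _
  have hc₁t : IsOfHodgeType (A.dim + C.dim) (A.X ⊗ C.X) (2 * p) p p c₁ :=
    hpp.map_of_isSmoothProjective hAC hA'C' H.hom.hom.hom
  have hmem : c₁ ∈ Submodule.span ℂ (hodgeProductClasses A C p) := h p c₁ hc₁r hc₁t
  -- `T^* H^* c = (n₁ n₂)^{2p} • c` is in the span of the product classes of `A' × C'`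
  have hT := map_prodMap_mem_span_hodgeProductClasses t₁ t₂ hmem
  rw [← hTdef, hc₁, complexBetti_map_map_of_comp_eq_nsmul_id hTH] at hT
  have hn : (((n₁ * n₂ : ℕ) : ℂ) ^ (2 * p)) ≠ 0 :=
    pow_ne_zero _ (Nat.cast_ne_zero.2 (mul_ne_zero hn₁ hn₂))
  exact (Submodule.smul_mem_iff _ hn).1 hT

/-! ### §3 Symmetry -/

/-- **The switch `C × A → A × C` carries exterior products of Hodge classes of `(A, C)` to exterior
products of Hodge classes of `(C, A)`**: `σ^*(pr_A^* a ∪ pr_C^* b) = pr_A'^* a ∪ pr_C'^* b` on `C × A`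
(primes: the projections of `C × A`), which equals `pr_C'^* b ∪ pr_A'^* a` by graded commutativity of
the cup product in even degrees (`(-1)^{2l·2k} = 1`). [cite: Hatcher2002, Prop. 3.10 and Thm. 3.11] -/
theorem map_prodSwap_mem_hodgeProductClasses {p : ℕ} {x : complexBetti (A.X ⊗ C.X) (2 * p)}
    (hx : x ∈ hodgeProductClasses A C p) :
    complexBetti.map (AbelianVariety.prodLift (AbelianVariety.snd C A) (AbelianVariety.fst C A)).hom.hom.hom
      (2 * p) x ∈ hodgeProductClasses C A p := by
  obtain ⟨l, k, hlk, a, b, ha, ha', hb, hb', rfl⟩ := hx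
  set σ : C.prod A ⟶ A.prod C := AbelianVariety.prodLift (AbelianVariety.snd C A) (AbelianVariety.fst C A)
    with hσdef
  have hσ₁ : σ ≫ AbelianVariety.fst A C = AbelianVariety.snd C A := AbelianVariety.prodLift_fst _ _
  have hσ₂ : σ ≫ AbelianVariety.snd A C = AbelianVariety.fst C A := AbelianVariety.prodLift_snd _ _
  have hFx : complexBetti.map σ.hom.hom.hom (2 * p)
      (cupProduct hlk (complexBetti.map (fst A.X C.X) (2 * l) a) (complexBetti.map (snd A.X C.X) (2 * k) b)) =
      cupProduct (X := ComplexPoints (C.X ⊗ A.X)) hlk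
        (complexBetti.map σ.hom.hom.hom (2 * l) (complexBetti.map (fst A.X C.X) (2 * l) a))
        (complexBetti.map σ.hom.hom.hom (2 * k) (complexBetti.map (snd A.X C.X) (2 * k) b)) :=
    cupProduct_map _ hlk _ _
  have hXa : complexBetti.map σ.hom.hom.hom (2 * l) (complexBetti.map (fst A.X C.X) (2 * l) a) =
      complexBetti.map (snd C.X A.X) (2 * l) a := by
    have e := abelianVarietyHom_map_map_apply σ (AbelianVariety.fst A C) a
    rw [hσ₁] at e
    exact e
  have hYb : complexBetti.map σ.hom.hom.hom (2 * k) (complexBetti.map (snd A.X C.X) (2 * k) b) =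
      complexBetti.map (fst C.X A.X) (2 * k) b := by
    have e := abelianVarietyHom_map_map_apply σ (AbelianVariety.snd A C) b
    rw [hσ₂] at e
    exact e
  have hkl : 2 * k + 2 * l = 2 * p := by omega
  have hcomm := cupProduct_gradedComm_holds (R := ℂ) (X := ComplexPoints (C.X ⊗ A.X)) hlk hkl
    (complexBetti.map (snd C.X A.X) (2 * l) a) (complexBetti.map (fst C.X A.X) (2 * k) b)
  have hsign : ((-1 : ℂ) ^ (2 * l * (2 * k))) = 1 := by
    rw [mul_assoc, pow_mul, neg_one_sq, one_pow]
  rw [hsign, one_smul] at hcomm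
  rw [hFx, hXa, hYb, hcomm]
  exact ⟨k, l, hkl, b, a, hb, hb', ha, ha', rfl⟩

/-- **`HodgeClassesProductSpan` is symmetric**: `HodgeClassesProductSpan A C → HodgeClassesProductSpan C A`.
For a rational `(p,p)`-class `c` on `C × A`, `τ^* c` (`τ : A × C → C × A` the switch) is a rational
`(p,p)`-class on `A × C`, hence a combination of exterior products; `c = σ^* τ^* c` (`σ ≫ τ = 𝟙`) is
then a combination of the switched exterior products. [cite: MoonenZarhin1999LowDim, §3 (3.1)]
[cite: Hatcher2002, Prop. 3.10 and Thm. 3.11] [cite: VoisinHodgeI2002, §7.3.2] -/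
theorem HodgeClassesProductSpan.symm (h : HodgeClassesProductSpan A C) : HodgeClassesProductSpan C A := by
  intro p c hc hpp
  have hA : IsSmoothProjective A.dim A.X := AbelianVariety.isSmoothProjective_holds
  have hC : IsSmoothProjective C.dim C.X := AbelianVariety.isSmoothProjective_holds
  have hAC : IsSmoothProjective (A.dim + C.dim) (A.X ⊗ C.X) := IsSmoothProjective.tensor_holds hA hC
  have hCA : IsSmoothProjective (C.dim + A.dim) (C.X ⊗ A.X) := IsSmoothProjective.tensor_holds hC hA
  set σ : C.prod A ⟶ A.prod C := AbelianVariety.prodLift (AbelianVariety.snd C A) (AbelianVariety.fst C A)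
    with hσdef
  set τ : A.prod C ⟶ C.prod A := AbelianVariety.prodLift (AbelianVariety.snd A C) (AbelianVariety.fst A C)
    with hτdef
  have hστ : σ ≫ τ = 𝟙 (C.prod A) := by
    apply AbelianVariety.prod_hom_ext
    · rw [Category.assoc, hτdef, AbelianVariety.prodLift_fst, hσdef, AbelianVariety.prodLift_snd,
        Category.id_comp]
    · rw [Category.assoc, hτdef, AbelianVariety.prodLift_snd, hσdef, AbelianVariety.prodLift_fst,
        Category.id_comp]
  -- `τ^* c` is a rational `(p,p)`-class on `A × C`, hence in the span of the product classes
  set c₁ : complexBetti (A.X ⊗ C.X) (2 * p) := complexBetti.map τ.hom.hom.hom (2 * p) c with hc₁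
  have hc₁r : IsRationalClass c₁ := hc.map _
  have hc₁t : IsOfHodgeType (A.dim + C.dim) (A.X ⊗ C.X) (2 * p) p p c₁ :=
    hpp.map_of_isSmoothProjective hAC hCA τ.hom.hom.hom
  have hmem : c₁ ∈ Submodule.span ℂ (hodgeProductClasses A C p) := h p c₁ hc₁r hc₁t
  -- `c = σ^* τ^* c`
  have hback : complexBetti.map σ.hom.hom.hom (2 * p) c₁ = c := by
    have e := abelianVarietyHom_map_map_apply σ τ c
    rw [hστ] at e
    refine e.trans ?_
    change complexBetti.map (𝟙 (C.X ⊗ A.X)) (2 * p) c = c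
    rw [complexBetti.map_id]
    rfl
  rw [← hback]
  refine Submodule.span_induction (p := fun x _ ↦
      complexBetti.map σ.hom.hom.hom (2 * p) x ∈ Submodule.span ℂ (hodgeProductClasses C A p)) ?_ ?_ ?_ ?_ hmem
  · intro x hx
    exact Submodule.subset_span (map_prodSwap_mem_hodgeProductClasses hx)
  · rw [map_zero]
    exact Submodule.zero_mem _
  · intro x y _ _ hx hy
    rw [map_add]
    exact Submodule.add_mem _ hx hy
  · intro s x _ hx
    rw [map_smul]
    exact Submodule.smul_mem _ s hx

/-- `HodgeClassesProductSpan A C ↔ HodgeClassesProductSpan C A`. [cite: MoonenZarhin1999LowDim, §3 (3.1)] -/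
theorem hodgeClassesProductSpan_comm : HodgeClassesProductSpan A C ↔ HodgeClassesProductSpan C A :=
  ⟨HodgeClassesProductSpan.symm, HodgeClassesProductSpan.symm⟩

/-! ### §4 One factor at a time: direct summands up to isogeny, abelian subvarieties, quotients, isogenies -/

/-- `HodgeClassesProductSpan A C → HodgeClassesProductSpan A' C` for a direct summand up to isogeny
`A'` of the first factor (`t ≫ h = [n]`, `n ≠ 0`). [cite: MumfordAV1970, §19 Remark p. 169]
[cite: vanGeemen1994HodgeAV, §3.6–3.7] -/
theorem HodgeClassesProductSpan.of_comp_eq_nsmul_id_left (t : A' ⟶ A) (h' : A ⟶ A') {n : ℕ} (hn : n ≠ 0)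
    (ht : t ≫ h' = n • 𝟙 A') (h : HodgeClassesProductSpan A C) : HodgeClassesProductSpan A' C :=
  h.of_comp_eq_nsmul_id t h' hn ht (𝟙 C) (𝟙 C) one_ne_zero (by rw [Category.comp_id, one_nsmul])

/-- `HodgeClassesProductSpan A C → HodgeClassesProductSpan A C'` for a direct summand up to isogeny
`C'` of the second factor (`t ≫ h = [n]`, `n ≠ 0`). [cite: MumfordAV1970, §19 Remark p. 169]
[cite: vanGeemen1994HodgeAV, §3.6–3.7] -/
theorem HodgeClassesProductSpan.of_comp_eq_nsmul_id_right (t : C' ⟶ C) (h' : C ⟶ C') {n : ℕ} (hn : n ≠ 0)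
    (ht : t ≫ h' = n • 𝟙 C') (h : HodgeClassesProductSpan A C) : HodgeClassesProductSpan A C' :=
  h.of_comp_eq_nsmul_id (𝟙 A) (𝟙 A) one_ne_zero (by rw [Category.comp_id, one_nsmul]) t h' hn ht

/-- **`HodgeClassesProductSpan` is inherited by abelian subvarieties of the first factor**
(Poincaré's complete reducibility: `ι ≫ q = [n]` for some `q`, `n ≠ 0`).
[cite: MumfordAV1970, §19 Thm. 1 (pp. 173–174)] [cite: MoonenZarhin1999LowDim, §3 (3.1)] -/
theorem HodgeClassesProductSpan.of_isClosedImmersion_left (ι : A' ⟶ A) [IsClosedImmersion (AbelianVariety.Hom.toSchemeHom ι)]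
    (h : HodgeClassesProductSpan A C) : HodgeClassesProductSpan A' C := by
  obtain ⟨q, n, hn, hq⟩ := exists_comp_eq_nsmul_id_of_isClosedImmersion ι
  exact h.of_comp_eq_nsmul_id_left ι q hn hq

/-- **`HodgeClassesProductSpan` is inherited by abelian subvarieties of the second factor.**
[cite: MumfordAV1970, §19 Thm. 1 (pp. 173–174)] [cite: MoonenZarhin1999LowDim, §3 (3.1)] -/
theorem HodgeClassesProductSpan.of_isClosedImmersion_right (ι : C' ⟶ C) [IsClosedImmersion (AbelianVariety.Hom.toSchemeHom ι)]
    (h : HodgeClassesProductSpan A C) : HodgeClassesProductSpan A C' := by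
  obtain ⟨q, n, hn, hq⟩ := exists_comp_eq_nsmul_id_of_isClosedImmersion ι
  exact h.of_comp_eq_nsmul_id_right ι q hn hq

/-- **`HodgeClassesProductSpan` is inherited by quotient abelian varieties of the first factor**
(a surjective homomorphism has a quasi-section `t ≫ f = [n]`).
[cite: MumfordAV1970, §19 Thm. 1 and Remark p. 169] [cite: MoonenZarhin1999LowDim, §3 (3.1)] -/
theorem HodgeClassesProductSpan.of_surjective_hom_left (f : A ⟶ A') [Surjective (AbelianVariety.Hom.toSchemeHom f)]
    (h : HodgeClassesProductSpan A C) : HodgeClassesProductSpan A' C := by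
  obtain ⟨t, n, hn, ht⟩ := exists_comp_eq_nsmul_id_of_surjective f
  exact h.of_comp_eq_nsmul_id_left t f hn ht

/-- **`HodgeClassesProductSpan` is inherited by quotient abelian varieties of the second factor.**
[cite: MumfordAV1970, §19 Thm. 1 and Remark p. 169] [cite: MoonenZarhin1999LowDim, §3 (3.1)] -/
theorem HodgeClassesProductSpan.of_surjective_hom_right (f : C ⟶ C') [Surjective (AbelianVariety.Hom.toSchemeHom f)]
    (h : HodgeClassesProductSpan A C) : HodgeClassesProductSpan A C' := by
  obtain ⟨t, n, hn, ht⟩ := exists_comp_eq_nsmul_id_of_surjective f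
  exact h.of_comp_eq_nsmul_id_right t f hn ht

/-- **Isogeny invariance, first factor, along an isogeny INTO `A`**: for an isogeny `f : A' → A`,
`HodgeClassesProductSpan A C → HodgeClassesProductSpan A' C` (quasi-inverse `g`, `f ≫ g = [n]`).
[cite: vanGeemen1994HodgeAV, §3.6 (p. 236)] [cite: MumfordAV1970, §19 Remark p. 169] -/
theorem HodgeClassesProductSpan.of_isIsogeny_left {f : A' ⟶ A} (hf : AbelianVariety.IsIsogeny f)
    (h : HodgeClassesProductSpan A C) : HodgeClassesProductSpan A' C := by
  obtain ⟨g, n, hn, hfg, -⟩ := AbelianVariety.IsIsogeny.exists_nsmul_inverse_holds hf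
  exact h.of_comp_eq_nsmul_id_left f g hn.ne' hfg

/-- **Isogeny invariance, first factor, along an isogeny OUT OF `A`**: for an isogeny `f : A → A'`,
`HodgeClassesProductSpan A C → HodgeClassesProductSpan A' C` (quasi-inverse `g`, `g ≫ f = [n]`).
[cite: vanGeemen1994HodgeAV, §3.6 (p. 236)] [cite: MumfordAV1970, §19 Remark p. 169] -/
theorem HodgeClassesProductSpan.of_isIsogeny_left' {f : A ⟶ A'} (hf : AbelianVariety.IsIsogeny f)
    (h : HodgeClassesProductSpan A C) : HodgeClassesProductSpan A' C := by
  obtain ⟨g, n, hn, -, hgf⟩ := AbelianVariety.IsIsogeny.exists_nsmul_inverse_holds hf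
  exact h.of_comp_eq_nsmul_id_left g f hn.ne' hgf

/-- **Isogeny invariance, second factor, along an isogeny INTO `C`.**
[cite: vanGeemen1994HodgeAV, §3.6 (p. 236)] [cite: MumfordAV1970, §19 Remark p. 169] -/
theorem HodgeClassesProductSpan.of_isIsogeny_right {f : C' ⟶ C} (hf : AbelianVariety.IsIsogeny f)
    (h : HodgeClassesProductSpan A C) : HodgeClassesProductSpan A C' := by
  obtain ⟨g, n, hn, hfg, -⟩ := AbelianVariety.IsIsogeny.exists_nsmul_inverse_holds hf
  exact h.of_comp_eq_nsmul_id_right f g hn.ne' hfg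

/-- **Isogeny invariance, second factor, along an isogeny OUT OF `C`.**
[cite: vanGeemen1994HodgeAV, §3.6 (p. 236)] [cite: MumfordAV1970, §19 Remark p. 169] -/
theorem HodgeClassesProductSpan.of_isIsogeny_right' {f : C ⟶ C'} (hf : AbelianVariety.IsIsogeny f)
    (h : HodgeClassesProductSpan A C) : HodgeClassesProductSpan A C' := by
  obtain ⟨g, n, hn, -, hgf⟩ := AbelianVariety.IsIsogeny.exists_nsmul_inverse_holds hf
  exact h.of_comp_eq_nsmul_id_right g f hn.ne' hgf

/-- **`HodgeClassesProductSpan` depends only on the isogeny classes of the two factors**: if `A'`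
is isogenous to `A` and `C'` to `C` (the tree's ordered relation `IsIsogenous X Y`: an isogeny
`X → Y` exists), then `HodgeClassesProductSpan A C → HodgeClassesProductSpan A' C'`.
[cite: vanGeemen1994HodgeAV, §3.6 (p. 236)] [cite: MoonenZarhin1999LowDim, §3 (3.1)] -/
theorem HodgeClassesProductSpan.of_isIsogenous (hA : AbelianVariety.IsIsogenous A' A)
    (hC : AbelianVariety.IsIsogenous C' C) (h : HodgeClassesProductSpan A C) :
    HodgeClassesProductSpan A' C' := by
  obtain ⟨f, hf⟩ := hA
  obtain ⟨g, hg⟩ := hC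
  exact (h.of_isIsogeny_left hf).of_isIsogeny_right hg

/-- The same with the isogenies pointing the other way (`A → A'`, `C → C'`).
[cite: vanGeemen1994HodgeAV, §3.6 (p. 236)] [cite: MoonenZarhin1999LowDim, §3 (3.1)] -/
theorem HodgeClassesProductSpan.of_isIsogenous' (hA : AbelianVariety.IsIsogenous A A')
    (hC : AbelianVariety.IsIsogenous C C') (h : HodgeClassesProductSpan A C) :
    HodgeClassesProductSpan A' C' := by
  obtain ⟨f, hf⟩ := hA
  obtain ⟨g, hg⟩ := hC
  exact (h.of_isIsogeny_left' hf).of_isIsogeny_right' hg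

/-- **`iff` form of isogeny invariance**: for `A` isogenous to `A'` and `C` isogenous to `C'`,
`HodgeClassesProductSpan A C ↔ HodgeClassesProductSpan A' C'`.
[cite: vanGeemen1994HodgeAV, §3.6 (p. 236)] [cite: MoonenZarhin1999LowDim, §3 (3.1)] -/
theorem hodgeClassesProductSpan_iff_of_isIsogenous (hA : AbelianVariety.IsIsogenous A A')
    (hC : AbelianVariety.IsIsogenous C C') :
    HodgeClassesProductSpan A C ↔ HodgeClassesProductSpan A' C' :=
  ⟨HodgeClassesProductSpan.of_isIsogenous' hA hC, HodgeClassesProductSpan.of_isIsogenous hA hC⟩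

end Literature.AlgebraicGeometry.HodgeTheory

end
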